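import Literature.AlgebraicGeometry.Kloosterman2025.TwoPlanesIntrinsicIdeals
import Literature.AlgebraicGeometry.AljovinMovasatiVillaflor2019.LinearCyclesIntersectionPairing
import Literature.AlgebraicGeometry.MovasatiVillaflor2018.LinearCyclePeriods
import Literature.AlgebraicGeometry.HodgeTheory.FermatPolynomialJacobianIdeal
import HarnessLib

/-!
# Movasati 2016, Theorem 13 for EVERY pair of linear cycles of the Fermat variety:
# `codim T(V_ℙ ∩ V_ℙ̌) = intdim^d_n(m)`, in all degrees, with the common image of the two classes

H. Movasati, *Why should one compute periods of algebraic cycles?* = *Gauss–Manin connection in disguise: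
Noether–Lefschetz and Hodge loci*, Asian J. Math. 21 (2017) = arXiv:1602.06607 [Movasati2016Periods]
(text read: held copy `paper:arxiv-1602.06607`, p. 12). **Theorem 13** (verbatim): "Let `ℙ^{n/2}, ℙ̌^{n/2}` be
two linear algebraic cycles in the Fermat variety with the intersection `ℙ^m`. We have
`intdim^d_n(m) := codim(V_{ℙ^{n/2}} ∩ V_{ℙ̌^{n/2}}) = 2·C_{1^{n/2+1},(d−1)^{n/2+1}} − C_{1^{n−m+1},(d−1)^{m+1}}`.
In particular, if `ℙ^{n/2}` does not intersect `ℙ̌^{n/2}` then `V_{ℙ^{n/2}}` intersects `V_{ℙ̌^{n/2}}` transversely.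
The proof is a simple application of Koszul complex and can be found in Section 17.9 of [ho13]." Here
`C_{1^a,(d−1)^b}` is the degree-`d` value of the Hilbert function of a complete intersection of type
`(1^a,(d−1)^b)` (tree `Kloosterman2023.linC a b d`, `intdim n d (m+1) = 2·linC(n/2+1,n/2+1,d) − linC(n+2−(m+1),m+1,d)`),
and `codim` is the codimension of the Zariski tangent space at the Fermat point, i.e. (Voisin II 6.2/Macaulay,
[cite: Kloosterman2025, Lemma 3.6, Remark 3.8]) `codim_{S_d}(I(ℙ) ∩ I(ℙ̌))_d` for the Artinian Gorenstein ideals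
`I(ℙ) = (J^F : P_ℙ)` of the two classes, `J^F = (x_s^{d−1})`.

The tree had this for the SAME pairing only (lit-g16 `Villaflor2022.hilbert_inf_two_linearCycles`,
`rank_eq_hilbert_inf_iff`; LEAN-MAP §28: "the two-block pair rows (different pairings) are NOT covered"). This
file proves it for two linear cycles in ARBITRARY mutual position, as an instance `F = Σ x_s^d` of
[cite: Kloosterman2025, Proposition 3.9] in the intrinsic/arbitrary-equations form of
`Kloosterman2025/TwoPlanesIntrinsicIdeals.lean`, in the vocabulary of the tree's arbitrary-position file
`AljovinMovasatiVillaflor2019/LinearCyclesIntersectionPairing.lean`: the first cycle is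
`ℙ_a = {x_{2j} = a_j x_{2j+1}}` on the variables `ι ⊕ ι` (`inl j ↔ x_{2j}`, `inr j ↔ x_{2j+1}`), the second is
`ℙ_{c,ρ} = {x_{ρ(t,0)} = c_t x_{ρ(t,1)}}` for ANY position map `ρ : T ⊕ T ≃ ι ⊕ ι`, and
**`m + 1 := nullity ρ a c`** is the dimension of the kernel of the joint linear system, `= dim(ℙ_a ∩ ℙ_{c,ρ}) + 1`
(tree `AljovinMovasatiVillaflor2019.finrank_ker_jointForm`).

## What is proved (theorems only; 0 definitions, 0 named facts), any field `K` with `d = e + 1` a unit, `e ≥ 1`,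
## `a_j^d = −1 = c_t^d`; `I₁ := fermatLinearCycleIdeal a e = (x_{2j} − a_j x_{2j+1}, x_s^e)`,
## `I₂ := (fermatLinearCycleIdeal c e).map (rename ρ)`, `J := (x_s^e : s ∈ ι ⊕ ι)`, `N := |ι|`, `n + 2 = 2N`

* `finrank_span_inf_span_eq_nullity` — **`m + 1` two ways**: the number of independent linear forms vanishing
  on both cycles, `dim(⟨x_{2j} − a_j x_{2j+1}⟩_K ∩ ⟨x_{ρ(t,0)} − c_t x_{ρ(t,1)}⟩_K)`, equals `nullity ρ a c` (the
  dimension of the common zero set; duality `dim W + dim W^⊥ = 2N`, Mathlib `Subspace.finrank_add_finrank_dualCoannihilator_eq`).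
* `hilbert_fermatLinearCycleIdeals_sup` — `h_{I₁+I₂}(t) = ciHilbert(e^{m+1})(t)` for every `t`.
* **`hilbert_fermatLinearCycleIdeals_inf_add`** — THEOREM 13 IN EVERY DEGREE:
  `h_{I₁∩I₂}(t) + ciHilbert(e^{m+1})(t) = 2·ciHilbert(e^{N})(t)`; **`hilbert_fermatLinearCycleIdeals_inf_eq_intdim`** —
  THEOREM 13 as printed: `codim_{S_d}(I₁ ∩ I₂)_d = intdim^d_n(m)` (`d = e+1`, `n = 2N − 2`).
* `span_X_pow_colon_rename_fermatLinearCyclePolynomial` — `(J : P_{c,ρ}) = I₂` (the tree's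
  `span_X_pow_colon_fermatLinearCyclePolynomial` in arbitrary position), so `I₁`, `I₂` ARE the two Artinian
  Gorenstein ideals `(J^F : P)` of the classes; `hilbert_fermatLinearCycleIdeal_eq_ciHilbert`,
  `hilbert_map_rename_fermatLinearCycleIdeal_eq_ciHilbert` — `h_{I₁}(t) = h_{I₂}(t) = ciHilbert(e^{N})(t)` (only `e ≥ 1`);
  `nullity_le_card` — `m + 1 ≤ N`; `hilbert_spans_sup_and_inf` — the four identities for the ideals written as
  `(equations) + J` (the transport from `Fin (2k+2)` along a relabelling `≃ ι ⊕ ι`).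
* THE COMMON IMAGE of the two classes in `R = S/J`: `((P_a) + J) ∩ ((P_{c,ρ}) + J) = (J : I₁ + I₂)`
  (`span_sup_inf_span_sup_eq_colon_sup`), `dim (J : I₁+I₂)_b − dim J_b = ciHilbert(e^{m+1})(a)` for
  `a + b = N'(e−1)`, `N' = 2N` (`finrank_colon_sup_sub`), the WINDOW form `= ciHilbert(e^{m+1})(b − (2N−m−1)(e−1))`
  and `= 0` below the window (`finrank_colon_sup_sub_eq_window`, `…_eq_zero_of_lt`).

Used by the Hodge-locus census cell (record `og81/FERMAT-PAIRS-ALL-DEGREES-g29.md`): with `k = N` pairs,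
`d = e+1`, `R = S/J`, `om_P = ±a·P_a`, THEOREM 1 (i) `Ann_R(om_P) = I_P R`, `rank α_t = h_k(t)`; (ii)
`c_t = 2h_k(t) − h_{m+1}(t)` FOR EVERY PAIR TYPE; (iii) `J_t := om R ∩ om′R = (0 :_R (I_P + I_P′)R)` and
`dim J_s = h_{m+1}(s − (2k−m−1)(d−2))` — with `m + 1 := dim(P ∩ P′) + 1` as the record defines it — are the
theorems below (the TYPE bookkeeping "`#`consistent cycles `= m + 1`" and (iv) remain cell-side).

HONEST SCOPE: the identification of `codim(V_ℙ ∩ V_ℙ̌)` with `codim_{S_d}(I₁∩I₂)_d` (Griffiths/IVHS, Lemma 3.6 of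
[cite: Kloosterman2025, Lemma 3.6]) and of `I(ℙ)` with `(J^F : P_ℙ)` via periods (MV18 Thm. 1) are cited, not
formalised; Movasati's own proof (Koszul complex, [ho13] §17.9) is replaced by Kloosterman's Prop. 3.9 route.
-/

noncomputable section

open MvPolynomial Module Literature.RingTheory.MvPolynomial

attribute [local instance] MvPolynomial.gradedAlgebra

namespace Literature.AlgebraicGeometry.Movasati2016

open Literature.AlgebraicGeometry.Kloosterman2023 Literature.AlgebraicGeometry.Kloosterman2025
  Literature.AlgebraicGeometry.HodgeTheory Literature.AlgebraicGeometry.Motives.UniversalHypersurface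
  Literature.AlgebraicGeometry.AljovinMovasatiVillaflor2019 Literature.RingTheory.GradedAlgebra
  Literature.AlgebraicGeometry.Villaflor2022

variable {K : Type*} [Field K] {ι T : Type*} [Fintype ι] [Fintype T] [DecidableEq ι] [DecidableEq T]

/-! ## §1. `m + 1`: common linear forms versus common zeros -/

section Nullity

omit [Fintype ι] [Fintype T] [DecidableEq ι] [DecidableEq T] in
/-- The equations `x_{2j} − a_j x_{2j+1}` of `ℙ_a` are linear forms. [cite: AljovinMovasatiVillaflor2019, §3.1] -/
theorem isHomogeneous_eq₁ (a : ι → K) (j : ι) :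
    ((X (Sum.inl j) : MvPolynomial (ι ⊕ ι) K) - C (a j) * X (Sum.inr j)).IsHomogeneous 1 := by
  refine (isHomogeneous_X K _).sub ?_
  simpa using (isHomogeneous_C (ι ⊕ ι) (a j)).mul (isHomogeneous_X K (Sum.inr j))

omit [Fintype ι] [Fintype T] [DecidableEq ι] [DecidableEq T] in
/-- The equations `x_{ρ(t,0)} − c_t x_{ρ(t,1)}` of `ℙ_{c,ρ}` are linear forms. [cite: AljovinMovasatiVillaflor2019, §3.1] -/
theorem isHomogeneous_eq₂ (ρ : T ⊕ T ≃ ι ⊕ ι) (c : T → K) (t : T) :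
    ((X (ρ (Sum.inl t)) : MvPolynomial (ι ⊕ ι) K) - C (c t) * X (ρ (Sum.inr t))).IsHomogeneous 1 := by
  refine (isHomogeneous_X K _).sub ?_
  simpa using (isHomogeneous_C (ι ⊕ ι) (c t)).mul (isHomogeneous_X K (ρ (Sum.inr t)))

omit [Fintype ι] in
/-- The equations of `ℙ_{c,ρ}` are linearly independent (each has its own variable `x_{ρ(t,0)}`).
[cite: AljovinMovasatiVillaflor2019, §3.1] -/
theorem linearIndependent_eq₂ (ρ : T ⊕ T ≃ ι ⊕ ι) (c : T → K) :
    LinearIndependent K fun t : T =>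
      ((X (ρ (Sum.inl t)) : MvPolynomial (ι ⊕ ι) K) - C (c t) * X (ρ (Sum.inr t))) := by
  classical
  rw [Fintype.linearIndependent_iff]
  intro g hg t
  have h := congrArg (coeff (Finsupp.single (ρ (Sum.inl t)) 1)) hg
  simp only [coeff_sum, coeff_smul, coeff_sub, coeff_C_mul, coeff_X, coeff_zero, smul_eq_mul,
    Finsupp.single_left_inj (one_ne_zero), ρ.injective.eq_iff, Sum.inl.injEq, reduceCtorEq, if_false,
    mul_zero, sub_zero] at h
  rw [Finset.sum_eq_single t (fun s _ hs => by rw [if_neg hs, mul_zero]) (fun h' => absurd (Finset.mem_univ t) h'),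
    if_pos rfl, mul_one] at h
  exact h

/-- The equations of `ℙ_a` are linearly independent. [cite: AljovinMovasatiVillaflor2019, §3.1] -/
theorem linearIndependent_eq₁ (a : ι → K) :
    LinearIndependent K fun j : ι => ((X (Sum.inl j) : MvPolynomial (ι ⊕ ι) K) - C (a j) * X (Sum.inr j)) := by
  have h := linearIndependent_eq₂ (Equiv.refl (ι ⊕ ι)) a
  simpa using h

/-- **`m + 1` two ways.** The number of independent linear forms vanishing on both linear cycles,
`dim(⟨x_{2j} − a_j x_{2j+1} : j⟩_K ∩ ⟨x_{ρ(t,0)} − c_t x_{ρ(t,1)} : t⟩_K)`, equals `nullity ρ a c`, the dimension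
of the space of common zeros of the `n + 2` equations (`= dim(ℙ_a ∩ ℙ_{c,ρ}) + 1`, tree `finrank_ker_jointForm`):
both are `(n+2) − rank` of the joint linear system (`dim W + dim W^⊥ = n + 2` for the span `W` of the equations
in the dual space). [cite: AljovinMovasatiVillaflor2019, §3.1, eq. (4)] [cite: Movasati2016Periods, Thm. 13] -/
theorem finrank_span_inf_span_eq_nullity (ρ : T ⊕ T ≃ ι ⊕ ι) (a : ι → K) (c : T → K) :
    finrank K ↥(Submodule.span K (Set.range fun j : ι =>
        ((X (Sum.inl j) : MvPolynomial (ι ⊕ ι) K) - C (a j) * X (Sum.inr j))) ⊓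
      Submodule.span K (Set.range fun t : T =>
        ((X (ρ (Sum.inl t)) : MvPolynomial (ι ⊕ ι) K) - C (c t) * X (ρ (Sum.inr t))))) =
      nullity ρ a c := by
  classical
  -- the functionals of the joint system
  let φ : ι → Module.Dual K (ι ⊕ ι → K) := fun j =>
    LinearMap.proj (Sum.inl j) - a j • LinearMap.proj (Sum.inr j)
  let ψ : T → Module.Dual K (ι ⊕ ι → K) := fun t =>
    LinearMap.proj (ρ (Sum.inl t)) - c t • LinearMap.proj (ρ (Sum.inr t))
  have hφx : ∀ j (x : ι ⊕ ι → K), φ j x = x (Sum.inl j) - a j * x (Sum.inr j) := fun j x => by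
    simp [φ]
  have hψx : ∀ t (x : ι ⊕ ι → K), ψ t x = x (ρ (Sum.inl t)) - c t * x (ρ (Sum.inr t)) := fun t x => by
    simp [ψ]
  set W : Submodule K (Module.Dual K (ι ⊕ ι → K)) := Submodule.span K (Set.range φ ∪ Set.range ψ) with hW
  -- (1) the kernel of the joint system is the coannihilator of `W`
  have hker : LinearMap.ker (jointForm ρ a c) = W.dualCoannihilator := by
    ext x
    rw [LinearMap.mem_ker, Submodule.mem_dualCoannihilator]
    constructor
    · intro hx f hf
      have hsub : Set.range φ ∪ Set.range ψ ⊆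
          (LinearMap.ker (Module.Dual.eval K (ι ⊕ ι → K) x) : Set (Module.Dual K (ι ⊕ ι → K))) := by
        rintro _ (⟨j, rfl⟩ | ⟨t, rfl⟩)
        · have h := congrFun hx (Sum.inl j)
          simp only [jointForm, LinearMap.coe_mk, AddHom.coe_mk, Sum.elim_inl, Pi.zero_apply] at h
          simpa [hφx] using h
        · have h := congrFun hx (Sum.inr t)
          simp only [jointForm, LinearMap.coe_mk, AddHom.coe_mk, Sum.elim_inr, Pi.zero_apply] at h
          simpa [hψx] using h
      exact (Submodule.span_le.mpr hsub) hf
    · intro hx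
      funext s
      rcases s with j | t
      · have h := hx (φ j) (Submodule.subset_span (Or.inl ⟨j, rfl⟩))
        rw [hφx] at h
        simpa [jointForm] using h
      · have h := hx (ψ t) (Submodule.subset_span (Or.inr ⟨t, rfl⟩))
        rw [hψx] at h
        simpa [jointForm] using h
  -- (2) duality count
  have hdual := Subspace.finrank_add_finrank_dualCoannihilator_eq W
  rw [← hker, finrank_ker_jointForm, Module.finrank_fintype_fun_eq_card, Fintype.card_sum] at hdual
  -- (3) `W ≅` the span of the linear forms, via `f ↦ Σ_s f(e_s) x_s`
  let Λ : Module.Dual K (ι ⊕ ι → K) →ₗ[K] MvPolynomial (ι ⊕ ι) K :=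
    { toFun := fun f => ∑ s, f (Pi.single s 1) • X s
      map_add' := fun f g => by
        simp only [LinearMap.add_apply, add_smul, Finset.sum_add_distrib]
      map_smul' := fun r f => by
        simp only [LinearMap.smul_apply, smul_eq_mul, RingHom.id_apply, Finset.smul_sum, smul_smul] }
  have hΛapply : ∀ f, Λ f = ∑ s, f (Pi.single s 1) • X s := fun f => rfl
  have hΛinj : Function.Injective Λ := by
    intro f g hfg
    refine (Pi.basisFun K (ι ⊕ ι)).ext fun s => ?_
    have h := congrArg (coeff (Finsupp.single s 1)) hfg
    rw [hΛapply, hΛapply] at h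
    simp only [coeff_sum, coeff_smul, coeff_X, smul_eq_mul, Finsupp.single_left_inj (one_ne_zero),
      mul_ite, mul_one, mul_zero, Finset.sum_ite_eq', Finset.mem_univ, if_true] at h
    simpa [Pi.basisFun_apply] using h
  have hΛφ : ∀ j, Λ (φ j) = X (Sum.inl j) - C (a j) * X (Sum.inr j) := fun j => by
    rw [hΛapply]
    simp only [hφx, Pi.single_apply, mul_ite, mul_one, mul_zero, sub_smul, Finset.sum_sub_distrib, ite_smul,
      one_smul, zero_smul, Finset.sum_ite_eq, Finset.mem_univ, if_true, smul_eq_C_mul]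
  have hΛψ : ∀ t, Λ (ψ t) = X (ρ (Sum.inl t)) - C (c t) * X (ρ (Sum.inr t)) := fun t => by
    rw [hΛapply]
    simp only [hψx, Pi.single_apply, mul_ite, mul_one, mul_zero, sub_smul, Finset.sum_sub_distrib, ite_smul,
      one_smul, zero_smul, Finset.sum_ite_eq, Finset.mem_univ, if_true, smul_eq_C_mul]
  have hmapφ : (Submodule.span K (Set.range φ)).map Λ =
      Submodule.span K (Set.range fun j : ι => ((X (Sum.inl j) : MvPolynomial (ι ⊕ ι) K) - C (a j) * X (Sum.inr j))) := by
    have hc : (⇑Λ ∘ φ) = fun j : ι => ((X (Sum.inl j) : MvPolynomial (ι ⊕ ι) K) - C (a j) * X (Sum.inr j)) :=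
      funext hΛφ
    rw [← Submodule.span_image, ← Set.range_comp, hc]
  have hmapψ : (Submodule.span K (Set.range ψ)).map Λ =
      Submodule.span K (Set.range fun t : T =>
        ((X (ρ (Sum.inl t)) : MvPolynomial (ι ⊕ ι) K) - C (c t) * X (ρ (Sum.inr t)))) := by
    have hc : (⇑Λ ∘ ψ) = fun t : T =>
        ((X (ρ (Sum.inl t)) : MvPolynomial (ι ⊕ ι) K) - C (c t) * X (ρ (Sum.inr t))) := funext hΛψ
    rw [← Submodule.span_image, ← Set.range_comp, hc]
  haveI := FiniteDimensional.span_of_finite K (Set.finite_range fun j : ι =>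
    ((X (Sum.inl j) : MvPolynomial (ι ⊕ ι) K) - C (a j) * X (Sum.inr j)))
  haveI := FiniteDimensional.span_of_finite K (Set.finite_range fun t : T =>
    ((X (ρ (Sum.inl t)) : MvPolynomial (ι ⊕ ι) K) - C (c t) * X (ρ (Sum.inr t))))
  -- (4) transport `sup` and `inf` along `Λ`
  have e3 : finrank K ↥W =
      finrank K ↥(Submodule.span K (Set.range fun j : ι =>
          ((X (Sum.inl j) : MvPolynomial (ι ⊕ ι) K) - C (a j) * X (Sum.inr j))) ⊔
        Submodule.span K (Set.range fun t : T =>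
          ((X (ρ (Sum.inl t)) : MvPolynomial (ι ⊕ ι) K) - C (c t) * X (ρ (Sum.inr t))))) := by
    rw [← hmapφ, ← hmapψ, ← Submodule.map_sup, ← Submodule.span_union]
    exact LinearEquiv.finrank_eq (Submodule.equivMapOfInjective Λ hΛinj _)
  have h2 := Submodule.finrank_sup_add_finrank_inf_eq
    (Submodule.span K (Set.range fun j : ι => ((X (Sum.inl j) : MvPolynomial (ι ⊕ ι) K) - C (a j) * X (Sum.inr j))))
    (Submodule.span K (Set.range fun t : T =>
        ((X (ρ (Sum.inl t)) : MvPolynomial (ι ⊕ ι) K) - C (c t) * X (ρ (Sum.inr t)))))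
  -- dimensions of the two spans: both families are linearly independent
  have hφli : finrank K ↥(Submodule.span K (Set.range fun j : ι =>
      ((X (Sum.inl j) : MvPolynomial (ι ⊕ ι) K) - C (a j) * X (Sum.inr j)))) = Fintype.card ι :=
    finrank_span_eq_card (linearIndependent_eq₁ a)
  have hψli : finrank K ↥(Submodule.span K (Set.range fun t : T =>
      ((X (ρ (Sum.inl t)) : MvPolynomial (ι ⊕ ι) K) - C (c t) * X (ρ (Sum.inr t))))) = Fintype.card T :=
    finrank_span_eq_card (linearIndependent_eq₂ ρ c)
  have hcard : Fintype.card T = Fintype.card ι := card_eq_of_pos ρ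
  omega

end Nullity

/-! ## §2. Relabelling the variables (the transport `Fin (2k+2) ≃ ι ⊕ ι`) -/

section Rename

variable {σ σ' : Type*}

/-- Membership in a relabelled ideal: `q ∈ I.map (rename θ) ↔ rename θ⁻¹ q ∈ I`. [folklore] -/
private theorem mem_map_rename_equiv_iff (θ : σ ≃ σ') (I : Ideal (MvPolynomial σ K)) (q : MvPolynomial σ' K) :
    q ∈ I.map (rename θ : MvPolynomial σ K →ₐ[K] MvPolynomial σ' K) ↔ rename θ.symm q ∈ I := by
  constructor
  · intro hq
    obtain ⟨p, hp, rfl⟩ := (Ideal.mem_map_iff_of_surjective (rename θ : MvPolynomial σ K →ₐ[K] MvPolynomial σ' K)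
      (fun q => ⟨rename θ.symm q, by rw [rename_rename, Equiv.self_comp_symm, rename_id, AlgHom.id_apply]⟩)).mp hq
    rwa [rename_rename, Equiv.symm_comp_self, rename_id, AlgHom.id_apply]
  · intro h
    have e : q = rename θ (rename θ.symm q) := by
      rw [rename_rename, Equiv.self_comp_symm, rename_id, AlgHom.id_apply]
    rw [e]
    exact Ideal.mem_map_of_mem _ h

/-- Relabelling the variables along a bijection commutes with intersections of ideals. [folklore] -/
private theorem map_rename_equiv_inf (θ : σ ≃ σ') (I J : Ideal (MvPolynomial σ K)) :
    (I ⊓ J).map (rename θ : MvPolynomial σ K →ₐ[K] MvPolynomial σ' K) =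
      I.map (rename θ : MvPolynomial σ K →ₐ[K] MvPolynomial σ' K) ⊓
        J.map (rename θ : MvPolynomial σ K →ₐ[K] MvPolynomial σ' K) := by
  ext q
  simp only [Ideal.mem_inf, mem_map_rename_equiv_iff]

/-- Relabelling the variables along a bijection commutes with colon ideals by one element. [folklore] -/
private theorem map_rename_equiv_colon_singleton (θ : σ ≃ σ') (I : Ideal (MvPolynomial σ K))
    (P : MvPolynomial σ K) :
    (I.colon {P}).map (rename θ : MvPolynomial σ K →ₐ[K] MvPolynomial σ' K) =
      (I.map (rename θ : MvPolynomial σ K →ₐ[K] MvPolynomial σ' K)).colon {rename θ P} := by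
  ext q
  rw [Submodule.mem_colon_singleton, mem_map_rename_equiv_iff, mem_map_rename_equiv_iff,
    Submodule.mem_colon_singleton, smul_eq_mul, smul_eq_mul, map_mul, rename_rename, Equiv.symm_comp_self,
    rename_id, AlgHom.id_apply]

/-- The monomial ideal `(x_s^e)` is carried to itself by a relabelling of the variables. [folklore] -/
private theorem map_rename_equiv_span_X_pow (θ : σ ≃ σ') (e : ℕ) :
    (Ideal.span (Set.range fun s : σ => (X s : MvPolynomial σ K) ^ e)).map
        (rename θ : MvPolynomial σ K →ₐ[K] MvPolynomial σ' K) =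
      Ideal.span (Set.range fun s : σ' => (X s : MvPolynomial σ' K) ^ e) := by
  rw [Ideal.map_span, ← Set.range_comp]
  congr 1
  ext q
  simp only [Set.mem_range, Function.comp_apply, map_pow, rename_X]
  constructor
  · rintro ⟨s, rfl⟩; exact ⟨θ s, rfl⟩
  · rintro ⟨s, rfl⟩; exact ⟨θ.symm s, by rw [Equiv.apply_symm_apply]⟩

/-- Relabelling preserves the dimension of every graded piece of an ideal. [folklore] -/
private theorem finrank_idealDegree_map_rename_equiv [Finite σ] [Finite σ'] (θ : σ ≃ σ')
    (I : Ideal (MvPolynomial σ K)) (t : ℕ) :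
    finrank K (idealDegree (I.map (rename θ : MvPolynomial σ K →ₐ[K] MvPolynomial σ' K)) t) =
      finrank K (idealDegree I t) := by
  have h := MovasatiVillaflor2018.hilbert_map_rename_equiv (K := K) θ I t
  have h0 := MovasatiVillaflor2018.hilbert_map_rename_equiv (K := K) θ (⊥ : Ideal (MvPolynomial σ K)) t
  rw [Ideal.map_bot, idealDegree_bot, idealDegree_bot] at h0
  simp only [finrank_bot, Nat.sub_zero] at h0
  have h1 := finrank_idealDegree_le (I.map (rename θ : MvPolynomial σ K →ₐ[K] MvPolynomial σ' K)) t
  have h2 := finrank_idealDegree_le I t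
  omega

end Rename

/-! ## §3. Theorem 13 for every pair of linear cycles: transport from `Kloosterman2025.TwoPlanesIntrinsicIdeals` -/

section Main

variable [Nonempty ι] (ρ : T ⊕ T ≃ ι ⊕ ι) (a : ι → K) (c : T → K) {e : ℕ} (he : 1 ≤ e)
  (hunit : IsUnit ((e + 1 : ℕ) : K)) (ha : ∀ j, a j ^ (e + 1) = -1) (hc : ∀ t, c t ^ (e + 1) = -1)

omit [Fintype T] [DecidableEq ι] [DecidableEq T] [Nonempty ι] in
/-- `x^{e+1} + y^{e+1} = (x − a y)·Σ_{l ≤ e} x^l (a y)^{e−l}` for `a^{e+1} = −1`: the Fermat form lies in the ideal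
of the equations of every linear cycle. [cite: Movasati2016Periods, §6] [cite: AljovinMovasatiVillaflor2019, §3.1] -/
theorem fermat_mem_span_eq₁ (ha : ∀ j, a j ^ (e + 1) = -1) :
    (∑ s : ι ⊕ ι, (X s : MvPolynomial (ι ⊕ ι) K) ^ (e + 1)) ∈
      Ideal.span (Set.range fun j : ι => ((X (Sum.inl j) : MvPolynomial (ι ⊕ ι) K) - C (a j) * X (Sum.inr j))) := by
  rw [Fintype.sum_sum_type, ← Finset.sum_add_distrib]
  refine Ideal.sum_mem _ fun j _ => ?_
  have key : (X (Sum.inl j) : MvPolynomial (ι ⊕ ι) K) ^ (e + 1) + X (Sum.inr j) ^ (e + 1) =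
      (X (Sum.inl j) - C (a j) * X (Sum.inr j)) *
        ∑ l ∈ Finset.range (e + 1), X (Sum.inl j) ^ l * (C (a j) * X (Sum.inr j)) ^ (e + 1 - 1 - l) := by
    rw [mul_comm, geom_sum₂_mul, mul_pow, ← map_pow, ha j, map_neg, map_one]
    ring
  rw [key]
  exact Ideal.mul_mem_right _ _ (Ideal.subset_span ⟨j, rfl⟩)

omit [Fintype ι] [DecidableEq ι] [DecidableEq T] [Nonempty ι] in
/-- The Fermat form lies in the ideal of the equations of `ℙ_{c,ρ}`. [cite: Movasati2016Periods, §6] -/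
theorem fermat_mem_span_eq₂ [Fintype ι] (hc : ∀ t, c t ^ (e + 1) = -1) :
    (∑ s : ι ⊕ ι, (X s : MvPolynomial (ι ⊕ ι) K) ^ (e + 1)) ∈
      Ideal.span (Set.range fun t : T =>
        ((X (ρ (Sum.inl t)) : MvPolynomial (ι ⊕ ι) K) - C (c t) * X (ρ (Sum.inr t)))) := by
  have h := Ideal.mem_map_of_mem (rename ρ : MvPolynomial (T ⊕ T) K →ₐ[K] MvPolynomial (ι ⊕ ι) K)
    (fermat_mem_span_eq₁ (K := K) c hc)
  rw [Ideal.map_span, ← Set.range_comp] at h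
  have e1 : (rename ρ : MvPolynomial (T ⊕ T) K →ₐ[K] MvPolynomial (ι ⊕ ι) K)
      (∑ s : T ⊕ T, (X s : MvPolynomial (T ⊕ T) K) ^ (e + 1)) = ∑ s : ι ⊕ ι, (X s : MvPolynomial (ι ⊕ ι) K) ^ (e + 1) := by
    rw [map_sum]
    simp only [map_pow, rename_X]
    exact Equiv.sum_comp ρ (fun s => (X s : MvPolynomial (ι ⊕ ι) K) ^ (e + 1))
  rw [e1] at h
  convert h using 3
  funext t
  simp only [Function.comp_apply, map_sub, map_mul, rename_X, rename_C]

omit [Fintype ι] [Fintype T] [DecidableEq ι] [DecidableEq T] [Nonempty ι] in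
/-- `fermatLinearCycleIdeal a e = (x_{2j} − a_j x_{2j+1} : j) + (x_s^e : s)`. [cite: DuqueFrancoVillaflor2025Join, Remark 7.1] -/
theorem fermatLinearCycleIdeal_eq_span_sup :
    fermatLinearCycleIdeal a e =
      Ideal.span (Set.range fun j : ι => ((X (Sum.inl j) : MvPolynomial (ι ⊕ ι) K) - C (a j) * X (Sum.inr j))) ⊔
        Ideal.span (Set.range fun s : ι ⊕ ι => (X s : MvPolynomial (ι ⊕ ι) K) ^ e) := by
  rw [fermatLinearCycleIdeal, Ideal.span_union]

omit [Fintype ι] [Fintype T] [DecidableEq ι] [DecidableEq T] [Nonempty ι] in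
/-- The ideal of the second cycle in arbitrary position: `(fermatLinearCycleIdeal c e).map (rename ρ) =
(x_{ρ(t,0)} − c_t x_{ρ(t,1)} : t) + (x_s^e : s)`. [cite: DuqueFrancoVillaflor2025Join, Remark 7.1]
[cite: AljovinMovasatiVillaflor2019, §3.1] -/
theorem map_rename_fermatLinearCycleIdeal_eq_span_sup :
    (fermatLinearCycleIdeal c e).map (rename ρ : MvPolynomial (T ⊕ T) K →ₐ[K] MvPolynomial (ι ⊕ ι) K) =
      Ideal.span (Set.range fun t : T =>
          ((X (ρ (Sum.inl t)) : MvPolynomial (ι ⊕ ι) K) - C (c t) * X (ρ (Sum.inr t)))) ⊔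
        Ideal.span (Set.range fun s : ι ⊕ ι => (X s : MvPolynomial (ι ⊕ ι) K) ^ e) := by
  have hc : ((rename ρ : MvPolynomial (T ⊕ T) K →ₐ[K] MvPolynomial (ι ⊕ ι) K) ∘ fun t : T =>
        ((X (Sum.inl t) : MvPolynomial (T ⊕ T) K) - C (c t) * X (Sum.inr t))) =
      fun t : T => ((X (ρ (Sum.inl t)) : MvPolynomial (ι ⊕ ι) K) - C (c t) * X (ρ (Sum.inr t))) := by
    funext t
    simp only [Function.comp_apply, map_sub, map_mul, rename_X, rename_C]
  rw [fermatLinearCycleIdeal_eq_span_sup, Ideal.map_sup, map_rename_equiv_span_X_pow, Ideal.map_span,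
    ← Set.range_comp, hc]

omit [Fintype ι] [DecidableEq ι] [DecidableEq T] [Nonempty ι] in
include he in
/-- **`(J : P_{c,ρ}) = I₂`** — the tree's `(x_s^e : s) : P_c = fermatLinearCycleIdeal c e` ([DFV] Remark 7.1 /
proof of Thm. 1.5) for the second cycle in ARBITRARY position: the Artinian Gorenstein ideal of the class of
`ℙ_{c,ρ}` is `(x_{ρ(t,0)} − c_t x_{ρ(t,1)}) + (x_s^e)`. [cite: DuqueFrancoVillaflor2025Join, Remark 7.1]
[cite: Movasati2016Periods, Thm. 13] -/
theorem span_X_pow_colon_rename_fermatLinearCyclePolynomial :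
    (Ideal.span (Set.range fun s : ι ⊕ ι => (X s : MvPolynomial (ι ⊕ ι) K) ^ e)).colon
        {rename ρ (fermatLinearCyclePolynomial c e)} =
      (fermatLinearCycleIdeal c e).map (rename ρ : MvPolynomial (T ⊕ T) K →ₐ[K] MvPolynomial (ι ⊕ ι) K) := by
  rw [← span_X_pow_colon_fermatLinearCyclePolynomial c e he, map_rename_equiv_colon_singleton,
    map_rename_equiv_span_X_pow]

include ha hc hunit he in
/-- **THE TRANSPORT.** All the Hilbert-function identities for `I₁ = (eqs of ℙ_a) + J`, `I₂ = (eqs of ℙ_{c,ρ}) + J`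
on the variables `ι ⊕ ι`, obtained from `Kloosterman2025.TwoPlanesIntrinsicIdeals` (variables `Fin (2k+2)`,
`J = J^F` for `F = Σ x_l^{e+1}`) along a relabelling `Fin (2k+2) ≃ ι ⊕ ι`; the number `r` of independent common
equations is `nullity ρ a c` (§1). [cite: Kloosterman2025, Proposition 3.9] [cite: Movasati2016Periods, Thm. 13] -/
theorem hilbert_spans_sup_and_inf (t : ℕ) :
    (finrank K (homogeneousSubmodule (ι ⊕ ι) K t) -
        finrank K (idealDegree
          ((Ideal.span (Set.range fun j : ι => ((X (Sum.inl j) : MvPolynomial (ι ⊕ ι) K) - C (a j) * X (Sum.inr j))) ⊔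
              Ideal.span (Set.range fun s : ι ⊕ ι => (X s : MvPolynomial (ι ⊕ ι) K) ^ e)) ⊔
            (Ideal.span (Set.range fun t : T =>
                ((X (ρ (Sum.inl t)) : MvPolynomial (ι ⊕ ι) K) - C (c t) * X (ρ (Sum.inr t)))) ⊔
              Ideal.span (Set.range fun s : ι ⊕ ι => (X s : MvPolynomial (ι ⊕ ι) K) ^ e))) t) =
      ciHilbert (List.replicate (nullity ρ a c) e) t) ∧
    (finrank K (homogeneousSubmodule (ι ⊕ ι) K t) -
        finrank K (idealDegree
          ((Ideal.span (Set.range fun j : ι => ((X (Sum.inl j) : MvPolynomial (ι ⊕ ι) K) - C (a j) * X (Sum.inr j))) ⊔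
              Ideal.span (Set.range fun s : ι ⊕ ι => (X s : MvPolynomial (ι ⊕ ι) K) ^ e)) ⊓
            (Ideal.span (Set.range fun t : T =>
                ((X (ρ (Sum.inl t)) : MvPolynomial (ι ⊕ ι) K) - C (c t) * X (ρ (Sum.inr t)))) ⊔
              Ideal.span (Set.range fun s : ι ⊕ ι => (X s : MvPolynomial (ι ⊕ ι) K) ^ e))) t)) +
      ciHilbert (List.replicate (nullity ρ a c) e) t = 2 * ciHilbert (List.replicate (Fintype.card ι) e) t ∧
    (finrank K (homogeneousSubmodule (ι ⊕ ι) K t) -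
        finrank K (idealDegree
          (Ideal.span (Set.range fun j : ι => ((X (Sum.inl j) : MvPolynomial (ι ⊕ ι) K) - C (a j) * X (Sum.inr j))) ⊔
            Ideal.span (Set.range fun s : ι ⊕ ι => (X s : MvPolynomial (ι ⊕ ι) K) ^ e)) t) =
      ciHilbert (List.replicate (Fintype.card ι) e) t) ∧
    (finrank K (homogeneousSubmodule (ι ⊕ ι) K t) -
        finrank K (idealDegree
          (Ideal.span (Set.range fun t : T =>
              ((X (ρ (Sum.inl t)) : MvPolynomial (ι ⊕ ι) K) - C (c t) * X (ρ (Sum.inr t)))) ⊔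
            Ideal.span (Set.range fun s : ι ⊕ ι => (X s : MvPolynomial (ι ⊕ ι) K) ^ e)) t) =
      ciHilbert (List.replicate (Fintype.card ι) e) t) := by
  classical
  -- sizes and the relabelling
  obtain ⟨k, hk⟩ : ∃ k, Fintype.card ι = k + 1 := Nat.exists_eq_add_one_of_ne_zero Fintype.card_ne_zero
  have hT : Fintype.card T = k + 1 := (card_eq_of_pos ρ).trans hk
  have hcard : Fintype.card (ι ⊕ ι) = 2 * k + 2 := by rw [Fintype.card_sum, hk]; ring
  let θ : Fin (2 * k + 2) ≃ ι ⊕ ι := (Fintype.equivFinOfCardEq hcard).symm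
  let κ₁ : Fin (k + 1) ≃ ι := (Fintype.equivFinOfCardEq hk).symm
  let κ₂ : Fin (k + 1) ≃ T := (Fintype.equivFinOfCardEq hT).symm
  let Ψ : MvPolynomial (ι ⊕ ι) K →ₐ[K] MvPolynomial (Fin (2 * k + 2)) K := rename θ.symm
  let Φ : MvPolynomial (Fin (2 * k + 2)) K →ₐ[K] MvPolynomial (ι ⊕ ι) K := rename θ
  have hΦΨ : ∀ q, Φ (Ψ q) = q := fun q => by
    show rename θ (rename θ.symm q) = q
    rw [rename_rename, Equiv.self_comp_symm, rename_id, AlgHom.id_apply]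
  -- the equations, on both sides
  set eqs₁ : ι → MvPolynomial (ι ⊕ ι) K := fun j => X (Sum.inl j) - C (a j) * X (Sum.inr j) with heqs₁
  set eqs₂ : T → MvPolynomial (ι ⊕ ι) K := fun t => X (ρ (Sum.inl t)) - C (c t) * X (ρ (Sum.inr t)) with heqs₂
  set J : Ideal (MvPolynomial (ι ⊕ ι) K) := Ideal.span (Set.range fun s : ι ⊕ ι => (X s : MvPolynomial (ι ⊕ ι) K) ^ e)
    with hJ
  let u' : Fin (k + 1) → MvPolynomial (Fin (2 * k + 2)) K := fun i => Ψ (eqs₁ (κ₁ i))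
  let v' : Fin (k + 1) → MvPolynomial (Fin (2 * k + 2)) K := fun i => Ψ (eqs₂ (κ₂ i))
  let F' : MvPolynomial (Fin (2 * k + 2)) K := Motives.fermatPolynomial K (2 * k) (e + 1)
  -- hypotheses of the Fin-side theorems
  have hd : 2 ≤ e + 1 := by omega
  have hu' : ∀ i, (u' i).IsHomogeneous 1 := fun i => (isHomogeneous_eq₁ a (κ₁ i)).rename_isHomogeneous
  have hv' : ∀ i, (v' i).IsHomogeneous 1 := fun i => (isHomogeneous_eq₂ ρ c (κ₂ i)).rename_isHomogeneous
  have hΨinj : LinearMap.ker Ψ.toLinearMap = ⊥ := LinearMap.ker_eq_bot.mpr (rename_injective _ θ.symm.injective)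
  have hlu' : LinearIndependent K u' :=
    ((linearIndependent_eq₁ a).comp κ₁ κ₁.injective).map' Ψ.toLinearMap hΨinj
  have hlv' : LinearIndependent K v' :=
    ((linearIndependent_eq₂ ρ c).comp κ₂ κ₂.injective).map' Ψ.toLinearMap hΨinj
  have hF' : F'.IsHomogeneous (e + 1) := Motives.isHomogeneous_fermatPolynomial (2 * k) (e + 1)
  have hF'eq : F' = Ψ (∑ s : ι ⊕ ι, (X s : MvPolynomial (ι ⊕ ι) K) ^ (e + 1)) := by
    show Motives.fermatPolynomial K (2 * k) (e + 1) = rename θ.symm (∑ s : ι ⊕ ι, (X s) ^ (e + 1))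
    rw [Motives.fermatPolynomial, map_sum]
    simp only [map_pow, rename_X]
    exact (Equiv.sum_comp θ.symm (fun l => (X l : MvPolynomial (Fin (2 * k + 2)) K) ^ (e + 1))).symm
  have hrange_u' : Set.range u' = Ψ '' Set.range eqs₁ := by
    rw [show u' = (Ψ ∘ eqs₁) ∘ κ₁ from rfl, κ₁.surjective.range_comp, Set.range_comp]
  have hrange_v' : Set.range v' = Ψ '' Set.range eqs₂ := by
    rw [show v' = (Ψ ∘ eqs₂) ∘ κ₂ from rfl, κ₂.surjective.range_comp, Set.range_comp]
  have hFu' : F' ∈ Ideal.span (Set.range u') := by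
    rw [hF'eq, hrange_u', ← Ideal.map_span]
    exact Ideal.mem_map_of_mem _ (fermat_mem_span_eq₁ a ha)
  have hFv' : F' ∈ Ideal.span (Set.range v') := by
    rw [hF'eq, hrange_v', ← Ideal.map_span]
    exact Ideal.mem_map_of_mem _ (fermat_mem_span_eq₂ ρ c hc)
  have hJ' : jacobianIdeal F' = Ideal.span (Set.range fun l : Fin (2 * k + 2) =>
      (X l : MvPolynomial (Fin (2 * k + 2)) K) ^ e) := jacobianIdeal_fermatPolynomial K (2 * k) e hunit
  have hXN : ∀ l, (X l : MvPolynomial (Fin (2 * k + 2)) K) ^ e ∈ jacobianIdeal F' := fun l => by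
    rw [hJ']; exact Ideal.subset_span ⟨l, rfl⟩
  -- the Fin-side statements
  have hA := hilbert_span_sup_span_sup_jacobianIdeal_eq_ciHilbert hd u' v' hu' hv' hlu' hlv' hF' hFu' hFv' hXN t
  have hB := hilbert_planeIdeals_inf_add_ciHilbert hd u' v' hu' hv' hlu' hlv' hF' hFu' hFv' hXN t
  have hC := hilbert_span_sup_jacobianIdeal_eq_ciHilbert hd u' hu' hlu' hF' hFu' hXN t
  have hD := hilbert_span_sup_jacobianIdeal_eq_ciHilbert hd v' hv' hlv' hF' hFv' hXN t
  simp only [Nat.add_sub_cancel] at hA hB hC hD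
  -- `r' = nullity`
  have hr : finrank K ↥(Submodule.span K (Set.range u') ⊓ Submodule.span K (Set.range v')) = nullity ρ a c := by
    rw [← finrank_span_inf_span_eq_nullity ρ a c, hrange_u', hrange_v',
      show (Ψ : MvPolynomial (ι ⊕ ι) K → MvPolynomial (Fin (2 * k + 2)) K) = Ψ.toLinearMap from rfl,
      Submodule.span_image, Submodule.span_image,
      ← Submodule.map_inf Ψ.toLinearMap (LinearMap.ker_eq_bot.mp hΨinj)]
    exact (LinearEquiv.finrank_eq
      (Submodule.equivMapOfInjective Ψ.toLinearMap (LinearMap.ker_eq_bot.mp hΨinj) _)).symm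
  rw [hr] at hA hB
  -- images of the ideals under `Φ = rename θ`
  have hΦu : (Ideal.span (Set.range u')).map Φ = Ideal.span (Set.range eqs₁) := by
    rw [Ideal.map_span, hrange_u', ← Set.image_comp]
    congr 1
    ext q; constructor
    · rintro ⟨p, hp, rfl⟩; simpa [hΦΨ] using hp
    · intro hq; exact ⟨q, hq, hΦΨ q⟩
  have hΦv : (Ideal.span (Set.range v')).map Φ = Ideal.span (Set.range eqs₂) := by
    rw [Ideal.map_span, hrange_v', ← Set.image_comp]
    congr 1
    ext q; constructor
    · rintro ⟨p, hp, rfl⟩; simpa [hΦΨ] using hp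
    · intro hq; exact ⟨q, hq, hΦΨ q⟩
  have hΦJ : (jacobianIdeal F').map Φ = J := by
    rw [hJ']; exact map_rename_equiv_span_X_pow θ e
  have hHF : ∀ I : Ideal (MvPolynomial (Fin (2 * k + 2)) K),
      finrank K (homogeneousSubmodule (ι ⊕ ι) K t) - finrank K (idealDegree (I.map Φ) t) =
        finrank K (homogeneousSubmodule (Fin (2 * k + 2)) K t) - finrank K (idealDegree I t) := fun I =>
    MovasatiVillaflor2018.hilbert_map_rename_equiv θ I t
  have hI : (Ideal.span (Set.range eqs₁) ⊔ J) ⊔ (Ideal.span (Set.range eqs₂) ⊔ J) =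
      Ideal.span (Set.range eqs₁) ⊔ Ideal.span (Set.range eqs₂) ⊔ J :=
    le_antisymm
      (sup_le (sup_le (le_sup_left.trans le_sup_left) le_sup_right)
        (sup_le (le_sup_right.trans le_sup_left) le_sup_right))
      (sup_le (sup_le (le_sup_left.trans le_sup_left) (le_sup_left.trans le_sup_right))
        (le_sup_right.trans le_sup_left))
  refine ⟨?_, ?_, ?_, ?_⟩
  · rw [hI, ← hA, ← hHF, Ideal.map_sup, Ideal.map_sup, hΦu, hΦv, hΦJ]
  · rw [hk, ← hB, ← hHF, map_rename_equiv_inf, Ideal.map_sup, Ideal.map_sup, hΦu, hΦv, hΦJ]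
  · rw [hk, ← hC, ← hHF, Ideal.map_sup, hΦu, hΦJ]
  · rw [hk, ← hD, ← hHF, Ideal.map_sup, hΦv, hΦJ]

end Main

/-! ## §4. Theorem 13 in the tree's vocabulary: `I₁ = fermatLinearCycleIdeal a e`, `I₂ = (fermatLinearCycleIdeal c e).map (rename ρ)` -/

section Theorem13

variable [Nonempty ι] (ρ : T ⊕ T ≃ ι ⊕ ι) (a : ι → K) (c : T → K) {e : ℕ} (he : 1 ≤ e)
  (hunit : IsUnit ((e + 1 : ℕ) : K)) (ha : ∀ j, a j ^ (e + 1) = -1) (hc : ∀ t, c t ^ (e + 1) = -1)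

omit [Fintype T] [DecidableEq ι] [DecidableEq T] [Nonempty ι] in
include he in
/-- **`h_{I(ℙ_a)}(t) = ciHilbert(e^{n/2+1})(t)`** — "HF_λ = HF_{[ℙ^{n/2}]}", the Hilbert function of the
Artinian Gorenstein ideal of a linear cycle of `X^d_n` is that of the complete intersection `(1^{n/2+1},(d−1)^{n/2+1})`
(`n/2 + 1 = |ι|`, `e = d − 1`; tree `hilbert_fermatLinearCycleIdeal_eq` + `hilbert_span_X_pow_eq_ciHilbert`).
[cite: DuqueFrancoVillaflor2025Join, Remark 7.1] [cite: Movasati2016Periods, Definition 1] -/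
theorem hilbert_fermatLinearCycleIdeal_eq_ciHilbert (t : ℕ) :
    finrank K (homogeneousSubmodule (ι ⊕ ι) K t) - finrank K (idealDegree (fermatLinearCycleIdeal a e) t) =
      ciHilbert (List.replicate (Fintype.card ι) e) t := by
  rw [hilbert_fermatLinearCycleIdeal_eq a e he t, ← map_rename_equiv_span_X_pow (Fintype.equivFin ι).symm e,
    MovasatiVillaflor2018.hilbert_map_rename_equiv, ← List.ofFn_const]
  exact hilbert_span_X_pow_eq_ciHilbert _ (fun _ => he) t

omit [DecidableEq ι] [DecidableEq T] [Nonempty ι] in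
include he in
/-- The same for the second cycle in arbitrary position: `h_{I(ℙ_{c,ρ})}(t) = ciHilbert(e^{n/2+1})(t)`.
[cite: DuqueFrancoVillaflor2025Join, Remark 7.1] [cite: Movasati2016Periods, Thm. 13] -/
theorem hilbert_map_rename_fermatLinearCycleIdeal_eq_ciHilbert (t : ℕ) :
    finrank K (homogeneousSubmodule (ι ⊕ ι) K t) -
        finrank K (idealDegree ((fermatLinearCycleIdeal c e).map
          (rename ρ : MvPolynomial (T ⊕ T) K →ₐ[K] MvPolynomial (ι ⊕ ι) K)) t) =
      ciHilbert (List.replicate (Fintype.card ι) e) t := by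
  rw [MovasatiVillaflor2018.hilbert_map_rename_equiv, ← card_eq_of_pos ρ]
  exact hilbert_fermatLinearCycleIdeal_eq_ciHilbert c he t

omit [Nonempty ι] in
/-- `m + 1 = nullity ρ a c ≤ n/2 + 1 = |ι|` (the common equations are among the `|ι|` equations of `ℙ_a`).
[cite: AljovinMovasatiVillaflor2019, §3.1] -/
theorem nullity_le_card : nullity ρ a c ≤ Fintype.card ι := by
  rw [← finrank_span_inf_span_eq_nullity ρ a c]
  haveI := Module.Finite.span_of_finite K (Set.finite_range fun j : ι =>
    ((X (Sum.inl j) : MvPolynomial (ι ⊕ ι) K) - C (a j) * X (Sum.inr j)))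
  exact (Submodule.finrank_mono inf_le_left).trans (finrank_span_eq_card (linearIndependent_eq₁ a)).le

omit [Fintype ι] [Fintype T] [DecidableEq ι] [DecidableEq T] [Nonempty ι] in
/-- `I₁ + I₂` is homogeneous and contains `J = (x_s^e)`. [cite: DuqueFrancoVillaflor2025Join, Remark 7.1] -/
theorem isHomogeneous_fermatLinearCycleIdeals_sup :
    (fermatLinearCycleIdeal a e ⊔ (fermatLinearCycleIdeal c e).map
        (rename ρ : MvPolynomial (T ⊕ T) K →ₐ[K] MvPolynomial (ι ⊕ ι) K)).IsHomogeneous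
        (homogeneousSubmodule (ι ⊕ ι) K) ∧
      Ideal.span (Set.range fun s : ι ⊕ ι => (X s : MvPolynomial (ι ⊕ ι) K) ^ e) ≤
        fermatLinearCycleIdeal a e ⊔ (fermatLinearCycleIdeal c e).map
          (rename ρ : MvPolynomial (T ⊕ T) K →ₐ[K] MvPolynomial (ι ⊕ ι) K) := by
  rw [fermatLinearCycleIdeal_eq_span_sup, map_rename_fermatLinearCycleIdeal_eq_span_sup]
  refine ⟨?_, le_sup_right.trans le_sup_left⟩
  have hJ : (Ideal.span (Set.range fun s : ι ⊕ ι => (X s : MvPolynomial (ι ⊕ ι) K) ^ e)).IsHomogeneous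
      (homogeneousSubmodule (ι ⊕ ι) K) :=
    Ideal.homogeneous_span _ _ (by rintro _ ⟨s, rfl⟩; exact ⟨e, isHomogeneous_X_pow s e⟩)
  exact ((Ideal.homogeneous_span _ _ (by rintro _ ⟨j, rfl⟩; exact ⟨1, isHomogeneous_eq₁ a j⟩)).sup hJ).sup
    ((Ideal.homogeneous_span _ _ (by rintro _ ⟨t, rfl⟩; exact ⟨1, isHomogeneous_eq₂ ρ c t⟩)).sup hJ)

omit [DecidableEq ι] [DecidableEq T] [Nonempty ι] in
include he in
/-- **The common image is the annihilator of `I₁ + I₂`**: in `R = S/J`, `J = (x_s^e)`, the intersection of the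
two principal ideals generated by the cycle polynomials `P_a` and `P_{c,ρ}` is `Ann_R(Ī₁ + Ī₂)`:
`((P_a) + J) ∩ ((P_{c,ρ}) + J) = (J : I₁ + I₂)` (Gorenstein duality `(J : (J : P)) = (P) + J`, tree
`span_X_pow_colon_colon_eq_sup`, with `(J : P_a) = I₁`, `(J : P_{c,ρ}) = I₂`) — the census's
`J_• := om R ∩ om′R = (0 :_R (I_P + I_{P′})R)`. [cite: Movasati2016Periods, Thm. 13] [cite: MeyerSmith2005, Lemma I.1.1] -/
theorem span_sup_inf_span_sup_eq_colon_sup :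
    (Ideal.span {fermatLinearCyclePolynomial a e} ⊔
        Ideal.span (Set.range fun s : ι ⊕ ι => (X s : MvPolynomial (ι ⊕ ι) K) ^ e)) ⊓
      (Ideal.span {rename ρ (fermatLinearCyclePolynomial c e)} ⊔
        Ideal.span (Set.range fun s : ι ⊕ ι => (X s : MvPolynomial (ι ⊕ ι) K) ^ e)) =
      (Ideal.span (Set.range fun s : ι ⊕ ι => (X s : MvPolynomial (ι ⊕ ι) K) ^ e)).colon
        ((fermatLinearCycleIdeal a e ⊔ (fermatLinearCycleIdeal c e).map
          (rename ρ : MvPolynomial (T ⊕ T) K →ₐ[K] MvPolynomial (ι ⊕ ι) K) :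
            Ideal (MvPolynomial (ι ⊕ ι) K)) : Set (MvPolynomial (ι ⊕ ι) K)) := by
  have h1 : (Ideal.span ({fermatLinearCyclePolynomial a e} : Set (MvPolynomial (ι ⊕ ι) K))).IsHomogeneous
      (homogeneousSubmodule (ι ⊕ ι) K) :=
    Ideal.homogeneous_span _ _ fun q hq => by
      rw [Set.mem_singleton_iff] at hq
      rw [hq]
      exact ⟨_, isHomogeneous_fermatLinearCyclePolynomial a e⟩
  have h2 : (Ideal.span ({rename ρ (fermatLinearCyclePolynomial c e)} :
      Set (MvPolynomial (ι ⊕ ι) K))).IsHomogeneous (homogeneousSubmodule (ι ⊕ ι) K) :=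
    Ideal.homogeneous_span _ _ fun q hq => by
      rw [Set.mem_singleton_iff] at hq
      rw [hq]
      exact ⟨_, (isHomogeneous_fermatLinearCyclePolynomial c e).rename_isHomogeneous⟩
  rw [colon_sup, ← span_X_pow_colon_fermatLinearCyclePolynomial a e he,
    ← span_X_pow_colon_rename_fermatLinearCyclePolynomial ρ c he,
    ← Ideal.colon_span (S := {fermatLinearCyclePolynomial a e}),
    ← Ideal.colon_span (S := {rename ρ (fermatLinearCyclePolynomial c e)}),
    span_X_pow_colon_colon_eq_sup he h1, span_X_pow_colon_colon_eq_sup he h2]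

include he hunit ha hc

/-- **`h_{I(ℙ_a)+I(ℙ_{c,ρ})}(t) = ciHilbert(e^{m+1})(t)`, `m + 1 = nullity ρ a c = dim(ℙ_a ∩ ℙ_{c,ρ}) + 1`** —
the sum of the two Artinian Gorenstein ideals of ANY two linear cycles of the Fermat variety has the Hilbert
function of the complete intersection `(1^{n+1−m},(d−1)^{m+1})` (Kloosterman's "`I₁+I₂` is a complete
intersection ideal with `k+c+1` generators of degree `1` and `k−c+1` generators of degree `d−1`" at `X_F`).
[cite: Movasati2016Periods, Thm. 13] [cite: Kloosterman2025, Proposition 3.9 (proof)] -/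
theorem hilbert_fermatLinearCycleIdeals_sup (t : ℕ) :
    finrank K (homogeneousSubmodule (ι ⊕ ι) K t) -
        finrank K (idealDegree (fermatLinearCycleIdeal a e ⊔ (fermatLinearCycleIdeal c e).map
          (rename ρ : MvPolynomial (T ⊕ T) K →ₐ[K] MvPolynomial (ι ⊕ ι) K)) t) =
      ciHilbert (List.replicate (nullity ρ a c) e) t := by
  rw [fermatLinearCycleIdeal_eq_span_sup, map_rename_fermatLinearCycleIdeal_eq_span_sup]
  exact (hilbert_spans_sup_and_inf ρ a c he hunit ha hc t).1

/-- **THEOREM 13 IN EVERY DEGREE, FOR EVERY PAIR OF LINEAR CYCLES OF THE FERMAT VARIETY**: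
`h_{I(ℙ_a) ∩ I(ℙ_{c,ρ})}(t) + ciHilbert(e^{m+1})(t) = 2·ciHilbert(e^{n/2+1})(t)` with `m + 1 = nullity ρ a c`
(`= dim(ℙ_a ∩ ℙ_{c,ρ}) + 1`) — any pairing `ρ`, any twists `a_j^d = −1 = c_t^d`, any field in which `d` is a unit.
At `t = d` this is `codim(V_{ℙ^{n/2}} ∩ V_{ℙ̌^{n/2}}) = intdim^d_n(m)` (next theorem).
[cite: Movasati2016Periods, Thm. 13] [cite: Kloosterman2025, Proposition 3.9] -/
theorem hilbert_fermatLinearCycleIdeals_inf_add (t : ℕ) :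
    (finrank K (homogeneousSubmodule (ι ⊕ ι) K t) -
        finrank K (idealDegree (fermatLinearCycleIdeal a e ⊓ (fermatLinearCycleIdeal c e).map
          (rename ρ : MvPolynomial (T ⊕ T) K →ₐ[K] MvPolynomial (ι ⊕ ι) K)) t)) +
      ciHilbert (List.replicate (nullity ρ a c) e) t = 2 * ciHilbert (List.replicate (Fintype.card ι) e) t := by
  rw [fermatLinearCycleIdeal_eq_span_sup, map_rename_fermatLinearCycleIdeal_eq_span_sup]
  exact (hilbert_spans_sup_and_inf ρ a c he hunit ha hc t).2.1

/-- **THEOREM 13 as printed**: `intdim^d_n(m) := codim(V_{ℙ^{n/2}} ∩ V_{ℙ̌^{n/2}}) =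
2·C_{1^{n/2+1},(d−1)^{n/2+1}} − C_{1^{n−m+1},(d−1)^{m+1}}` for EVERY pair of linear cycles of `X^d_n` meeting in
a `ℙ^m` (`n = 2|ι| − 2`, `d = e + 1`, `m + 1 = nullity ρ a c`; the left-hand side read as the codimension
`dim S_d − dim(I(ℙ) ∩ I(ℙ̌))_d` of the Zariski tangent space at the Fermat point, tree `Kloosterman2023.intdim`).
[cite: Movasati2016Periods, Thm. 13] -/
theorem hilbert_fermatLinearCycleIdeals_inf_eq_intdim :
    ((finrank K (homogeneousSubmodule (ι ⊕ ι) K (e + 1)) -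
        finrank K (idealDegree (fermatLinearCycleIdeal a e ⊓ (fermatLinearCycleIdeal c e).map
          (rename ρ : MvPolynomial (T ⊕ T) K →ₐ[K] MvPolynomial (ι ⊕ ι) K)) (e + 1)) : ℕ) : ℤ) =
      intdim (2 * (Fintype.card ι - 1)) (e + 1) (nullity ρ a c) := by
  have h := hilbert_fermatLinearCycleIdeals_inf_add ρ a c he hunit ha hc (e + 1)
  have hN : 1 ≤ Fintype.card ι := Fintype.card_pos
  unfold intdim linC
  rw [ciHilbert_replicate_one_append, ciHilbert_replicate_one_append,
    show 2 * (Fintype.card ι - 1) / 2 + 1 = Fintype.card ι by omega, Nat.add_sub_cancel]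
  omega

/-! ## §5. The common image of the two classes in `R = S/(x_s^e)` and its window -/

/-- **Macaulay duality for the common image**: `dim (J : I₁+I₂)_b − dim J_b = ciHilbert(e^{m+1})(a)` for
`a + b = (n+2)(d−2) = |ι ⊕ ι|·(e−1)` (tree `finrank_idealDegree_span_X_pow_colon_sub` + Theorem 13's
`h_{I₁+I₂} = h_{m+1}`): the dimension of the census's common image `(om R ∩ om′R)_b`.
[cite: Movasati2016Periods, Thm. 13] [cite: MeyerSmith2005, Lemma I.1.1] [cite: BrunsHerzog1998, Proposition 3.2.12 (b)] -/
theorem finrank_colon_sup_sub {a₀ b : ℕ} (hab : a₀ + b = Fintype.card (ι ⊕ ι) * (e - 1)) :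
    finrank K (idealDegree ((Ideal.span (Set.range fun s : ι ⊕ ι => (X s : MvPolynomial (ι ⊕ ι) K) ^ e)).colon
        ((fermatLinearCycleIdeal a e ⊔ (fermatLinearCycleIdeal c e).map
          (rename ρ : MvPolynomial (T ⊕ T) K →ₐ[K] MvPolynomial (ι ⊕ ι) K) :
            Ideal (MvPolynomial (ι ⊕ ι) K)) : Set (MvPolynomial (ι ⊕ ι) K))) b) -
        finrank K (idealDegree (Ideal.span (Set.range fun s : ι ⊕ ι => (X s : MvPolynomial (ι ⊕ ι) K) ^ e)) b) =
      ciHilbert (List.replicate (nullity ρ a c) e) a₀ := by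
  obtain ⟨hhom, hJI⟩ := isHomogeneous_fermatLinearCycleIdeals_sup ρ a c (e := e)
  rw [finrank_idealDegree_span_X_pow_colon_sub he hhom hJI hab]
  exact hilbert_fermatLinearCycleIdeals_sup ρ a c he hunit ha hc a₀

/-- **The window**: for `(2|ι| − (m+1))(e−1) ≤ b ≤ 2|ι|(e−1)` the common image has
`dim (J : I₁+I₂)_b − dim J_b = ciHilbert(e^{m+1})(b − (2|ι|−(m+1))(e−1))` (Gorenstein symmetry of
`ciHilbert(e^{m+1})`, socle degree `(m+1)(e−1)`) — the census's `dim J_s = h_{m+1}(t − c′(d−2))`,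
`s = t + k(d−2)`, `c′ = k − 1 − m`, `k = |ι|`. [cite: Movasati2016Periods, Thm. 13] [cite: Kloosterman2025, Example 3.16] -/
theorem finrank_colon_sup_sub_eq_window {b : ℕ}
    (hb₁ : (2 * Fintype.card ι - nullity ρ a c) * (e - 1) ≤ b) (hb₂ : b ≤ 2 * Fintype.card ι * (e - 1)) :
    finrank K (idealDegree ((Ideal.span (Set.range fun s : ι ⊕ ι => (X s : MvPolynomial (ι ⊕ ι) K) ^ e)).colon
        ((fermatLinearCycleIdeal a e ⊔ (fermatLinearCycleIdeal c e).map
          (rename ρ : MvPolynomial (T ⊕ T) K →ₐ[K] MvPolynomial (ι ⊕ ι) K) :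
            Ideal (MvPolynomial (ι ⊕ ι) K)) : Set (MvPolynomial (ι ⊕ ι) K))) b) -
        finrank K (idealDegree (Ideal.span (Set.range fun s : ι ⊕ ι => (X s : MvPolynomial (ι ⊕ ι) K) ^ e)) b) =
      ciHilbert (List.replicate (nullity ρ a c) e) (b - (2 * Fintype.card ι - nullity ρ a c) * (e - 1)) := by
  have hrk : nullity ρ a c ≤ Fintype.card ι := nullity_le_card ρ a c
  set r := nullity ρ a c with hr
  have hcard : Fintype.card (ι ⊕ ι) = 2 * Fintype.card ι := by rw [Fintype.card_sum]; ring
  have h1 : (2 * Fintype.card ι - r) * (e - 1) + r * (e - 1) = 2 * Fintype.card ι * (e - 1) := by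
    rw [← Nat.add_mul]; congr 1; omega
  have hab : (2 * Fintype.card ι * (e - 1) - b) + b = Fintype.card (ι ⊕ ι) * (e - 1) := by
    rw [hcard]; omega
  rw [finrank_colon_sup_sub ρ a c he hunit ha hc hab, ← List.ofFn_const]
  refine ciHilbert_ofFn_symm (fun _ : Fin r => e) (fun _ => by omega) ?_
  simp only [Finset.sum_const, Finset.card_univ, Fintype.card_fin, smul_eq_mul]
  omega

/-- **Below the window the common image is `J` itself**: for `b < (2|ι| − (m+1))(e−1)`,
`dim (J : I₁+I₂)_b = dim J_b`. [cite: Movasati2016Periods, Thm. 13] [cite: Kloosterman2025, Example 3.16] -/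
theorem finrank_colon_sup_sub_eq_zero_of_lt {b : ℕ} (hb : b < (2 * Fintype.card ι - nullity ρ a c) * (e - 1)) :
    finrank K (idealDegree ((Ideal.span (Set.range fun s : ι ⊕ ι => (X s : MvPolynomial (ι ⊕ ι) K) ^ e)).colon
        ((fermatLinearCycleIdeal a e ⊔ (fermatLinearCycleIdeal c e).map
          (rename ρ : MvPolynomial (T ⊕ T) K →ₐ[K] MvPolynomial (ι ⊕ ι) K) :
            Ideal (MvPolynomial (ι ⊕ ι) K)) : Set (MvPolynomial (ι ⊕ ι) K))) b) -
        finrank K (idealDegree (Ideal.span (Set.range fun s : ι ⊕ ι => (X s : MvPolynomial (ι ⊕ ι) K) ^ e)) b) = 0 := by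
  have hrk : nullity ρ a c ≤ Fintype.card ι := nullity_le_card ρ a c
  set r := nullity ρ a c with hr
  have hcard : Fintype.card (ι ⊕ ι) = 2 * Fintype.card ι := by rw [Fintype.card_sum]; ring
  have h1 : (2 * Fintype.card ι - r) * (e - 1) + r * (e - 1) = 2 * Fintype.card ι * (e - 1) := by
    rw [← Nat.add_mul]; congr 1; omega
  have hab : (2 * Fintype.card ι * (e - 1) - b) + b = Fintype.card (ι ⊕ ι) * (e - 1) := by
    rw [hcard]; omega
  rw [finrank_colon_sup_sub ρ a c he hunit ha hc hab, ← List.ofFn_const]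
  have hpos := ciHilbert_ofFn_pos_iff (fun _ : Fin r => e) (fun _ => by omega)
    (t := 2 * Fintype.card ι * (e - 1) - b)
  simp only [Finset.sum_const, Finset.card_univ, Fintype.card_fin, smul_eq_mul] at hpos
  have hnot : ¬ (2 * Fintype.card ι * (e - 1) - b ≤ r * (e - 1)) := by omega
  exact Nat.eq_zero_of_not_pos fun h0 => hnot (hpos.mp h0)

end Theorem13



end Literature.AlgebraicGeometry.Movasati2016
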